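import Summits.CriticalPhenomena.CardyFormulaZ2.Theorems.CardyFlipRussoVoronoiHubFromSmirnovReduction
import Summits.CriticalPhenomena.CardyFormulaZ2.Theorems.CardyFlipRussoVoronoiHubFromSmirnovStubIdentificationCovariance

/-!
# Route-level split of the crux `CardyFlipRusso.VoronoiHubFromSmirnov` (stmt-CriticalPhenomena-6433) — the glue, PROVED

Crux-strategist `planner-cstrat-stmt-CriticalPhenomena-6433-s2-0` (2026-08-17), re-deriving and superseding the
s1 evidence file of the same name (2026-08-17T03:50Z, not visible from jailed seats).  The crux is — sorry-free,
in the tree — `DensityBlind ∧ Sig.stub_conformalTransport ∧ Sig.stub_identification`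
(`VoronoiHubFromSmirnov_of_densityBlind`, p126642).  The three conjuncts are of three different KINDS (Benjamini–Schramm's
1998 Density-Invariance Conjecture 10.1, OPEN, no conformal map in it; BS98 Thm 2.1, a published XL theorem; the
SLE₆-identification programme with conformal invariance as INPUT, shared with `CardyUniqueLimit.CardyRigidity`
stmt-0746 / `CardyViaSLE6.CovariantLimitIsSLE6` stmt-14293), so the route-level decomposition files them as three
children of the crux.  A route file cannot import this line's `Defs` module (it imports the route file), hence the
children are spelled SELF-CONTAINED over `Literature` + Mathlib, quantifying over Poisson laws (`IsPoissonPointProcess`)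
instead of the line's chooser `poissonLaw`, and over IMAGE DATA `S.carrier = h '' R.carrier ∧ ∀ i, S.arc i = h '' R.arc i`
instead of `R.imageUnivalent h …` (tree convention, `Literature/Probability/RandomPlanarGeometry/ImageUnivalent.lean`).

This file:
* the three child statements VERBATIM as filed in `children.json`, as hypothesis TYPES only (so that the gate's glue
  item `VoronoiHubFromSmirnovOfSubs := VoronoiDensityInvariance → VoronoiConformalTransport → VoronoiCIRigidity →
  VoronoiHubFromSmirnov` unfolds to the type of `VoronoiHubFromSmirnov_of_subs` below);
* the bridges `densityBlind_of_statement`, `conformalTransport_of_statement`, `identification_of_statement` onto the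
  line's `DensityBlind`, `Sig.stub_conformalTransport`, `Sig.stub_identification` (Rényi uniqueness / Kingman existence:
  `isPoissonPointProcess_poissonLaw_volume`, `isPoissonPointProcess_poissonLaw_intensity`; `crossEvent_congr`;
  `intensity_one`);
* `VoronoiHubFromSmirnov_of_subs` — the split glue, BY NAME onto the route decl, via the landed
  `VoronoiHubFromSmirnov_of_densityBlind`.

Nothing is asserted: no `sorry`, no new axiom.  To file the split (lead on its final cycle / tenure planner):
land this file as `Theorems/CardyFlipRussoVoronoiHubFromSmirnovSplit.lean --supports stmt-CriticalPhenomena-6433`, then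
`ledger route edit route-CriticalPhenomena-CardyFlipRusso --split VoronoiHubFromSmirnov --into children.json
 --glue-by Summit.CriticalPhenomena.CardyFormulaZ2.Cruxes.VoronoiHubFromSmirnov.MoebiusExactDelaunayDilationWard.VoronoiHubFromSmirnov_of_subs`
(children.json = crux dir `Split-children.json`).
-/

noncomputable section

namespace Summit.CriticalPhenomena.CardyFormulaZ2.Cruxes.VoronoiHubFromSmirnov.MoebiusExactDelaunayDilationWard

open scoped Topology ENNReal Interval
open Filter Set MeasureTheory
open Literature.Analysis.FunctionSpaces
open Literature.Probability.RandomPlanarGeometry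

/-! ### The three children (S-form)

The three route-level child statements are NOT declared here as `def … : Prop` (a Theorems file declares no
unregistered facts); they appear verbatim as the hypothesis types of the bridges and of
`VoronoiHubFromSmirnov_of_subs` below, exactly as filed in `children.json`:

* CHILD 1 `VoronoiDensityInvariance` (crux) — Benjamini–Schramm Density-Invariance Conjecture 10.1, weak (difference)
  form, for smooth positive profiles `ρ ≡ 1` off a compact set: the annealed continuum crossing probability of every
  conformal rectangle is asymptotically the same for Poisson nuclei of intensity `ρ(δz) dz` and of Lebesgue intensity
  (= the line's `DensityBlind`);
* CHILD 2 `VoronoiConformalTransport` (support) — BS98 Thm 2.1 re-cut for Jordan conformal rectangles: conformal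
  transport of the homogeneous model on the image rectangle onto the model with profile `ρ = ‖h′‖²` near `closure Ω`
  (⇒ the line's `Sig.stub_conformalTransport`);
* CHILD 3 `VoronoiCIRigidity` (crux) — asymptotic conformal invariance (difference form, smooth image data) of the
  annealed crossing probabilities of the homogeneous Poisson–Voronoi model forces every subsequential crossing limit to
  be `cardyFunction (crossRatio x)` (⇒ the line's `Sig.stub_identification`).
-/

/-! ### Elementary identities -/

/-- The crossing event sees only the closed carrier and the arcs `0` and `2`. -/
theorem crossEvent_congr {S S' : ConformalRectangle} (hc : S.carrier = S'.carrier)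
    (h0 : S.arc 0 = S'.arc 0) (h2 : S.arc 2 = S'.arc 2) (δ : ℝ) :
    crossEvent S δ = crossEvent S' δ := by
  unfold crossEvent
  rw [hc, h0, h2]

/-- Image data identify the crossing event with that of `R.imageUnivalent h`. -/
theorem crossEvent_eq_of_image_data (R S : ConformalRectangle) (h : ℂ → ℂ)
    (hd : DifferentiableOn ℂ h (closure R.carrier)) (hi : InjOn h (closure R.carrier))
    (hc : S.carrier = h '' R.carrier) (ha : ∀ i : Fin 4, S.arc i = h '' R.arc i) (δ : ℝ) :
    crossEvent S δ = crossEvent (R.imageUnivalent h hd hi) δ := by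
  refine crossEvent_congr ?_ ?_ ?_ δ
  · rw [hc, MarkedDomain.carrier_imageUnivalent]
  · rw [ha 0, MarkedDomain.arc_imageUnivalent]
  · rw [ha 2, MarkedDomain.arc_imageUnivalent]

/-- At `t = 1` the density path is the profile itself. -/
theorem intensity_one (ρ : ℂ → ℝ) (δ : ℝ) :
    intensity ρ 1 δ = volume.withDensity fun z => ENNReal.ofReal (ρ ((δ : ℂ) * z)) := by
  unfold intensity densityPath
  congr 1
  funext z
  congr 1
  ring

/-! ### Bridges onto the line's statements -/

/-- CHILD 1 ⇒ `DensityBlind`. -/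
theorem densityBlind_of_statement
    (h : ∀ (ρ : ℂ → ℝ), ContDiff ℝ (⊤ : ℕ∞) ρ → HasCompactSupport (fun x => ρ x - 1) → (∀ x, 0 < ρ x) → ∀ (P : ℝ → MeasureTheory.Measure (Literature.Analysis.FunctionSpaces.PointConfig ℂ)) (Q : MeasureTheory.Measure (Literature.Analysis.FunctionSpaces.PointConfig ℂ)), (∀ δ : ℝ, 0 < δ → Literature.Analysis.FunctionSpaces.IsPoissonPointProcess ((MeasureTheory.volume : MeasureTheory.Measure ℂ).withDensity (fun z => ENNReal.ofReal (ρ ((δ : ℂ) * z)))) (P δ)) → Literature.Analysis.FunctionSpaces.IsPoissonPointProcess (MeasureTheory.volume : MeasureTheory.Measure ℂ) Q → ∀ R : Literature.Probability.RandomPlanarGeometry.ConformalRectangle, Filter.Tendsto (fun δ : ℝ => ((P δ).prod (P δ)).real {c | ∃ x ∈ R.arc 0, ∃ y ∈ R.arc 2, JoinedIn (closure R.carrier ∩ {z | Metric.infDist (z / ((δ : ℝ) : ℂ)) (c.1 : Set ℂ) ≤ Metric.infDist (z / ((δ : ℝ) : ℂ)) (c.2 : Set ℂ)}) x y} - (Q.prod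 Q).real {c | ∃ x ∈ R.arc 0, ∃ y ∈ R.arc 2, JoinedIn (closure R.carrier ∩ {z | Metric.infDist (z / ((δ : ℝ) : ℂ)) (c.1 : Set ℂ) ≤ Metric.infDist (z / ((δ : ℝ) : ℂ)) (c.2 : Set ℂ)}) x y}) (nhdsWithin (0 : ℝ) (Set.Ioi (0 : ℝ))) (nhds (0 : ℝ))) :
    DensityBlind := by
  intro ρ hρ R
  have hP : ∀ δ : ℝ, 0 < δ → IsPoissonPointProcess
      ((volume : Measure ℂ).withDensity fun z => ENNReal.ofReal (ρ ((δ : ℂ) * z)))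
      (poissonLaw (intensity ρ 1 δ)) := by
    intro δ _
    have := isPoissonPointProcess_poissonLaw_intensity ρ hρ.continuous 1 δ
    rwa [intensity_one] at this ⊢
  have hQ : IsPoissonPointProcess (volume : Measure ℂ) (poissonLaw (volume : Measure ℂ)) :=
    isPoissonPointProcess_poissonLaw_volume
  have key := h ρ hρ.1 hρ.2.1 hρ.2.2 (fun δ => poissonLaw (intensity ρ 1 δ)) (poissonLaw volume) hP hQ R
  refine key.congr (fun δ => ?_)
  show _ = crossProb ρ 1 R δ - crossProb ρ 0 R δ
  rw [crossProb_zero]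
  rfl

/-- CHILD 2 ⇒ `Sig.stub_conformalTransport`. -/
theorem conformalTransport_of_statement
    (h : ∀ (R S : Literature.Probability.RandomPlanarGeometry.ConformalRectangle) (h : ℂ → ℂ) (U : Set ℂ), IsOpen U → closure R.carrier ⊆ U → DifferentiableOn ℂ h U → Set.InjOn h U → S.carrier = h '' R.carrier → (∀ i : Fin 4, S.arc i = h '' R.arc i) → ∃ ρ : ℂ → ℝ, (ContDiff ℝ (⊤ : ℕ∞) ρ ∧ HasCompactSupport (fun x => ρ x - 1) ∧ ∀ x, 0 < ρ x) ∧ (∃ V : Set ℂ, IsOpen V ∧ closure R.carrier ⊆ V ∧ ∀ z ∈ V, ρ z = ‖deriv h z‖ ^ 2) ∧ ∀ (P : ℝ → MeasureTheory.Measure (Literature.Analysis.FunctionSpaces.PointConfig ℂ)) (Q : MeasureTheory.Measure (Literature.Analysis.FunctionSpaces.PointConfig ℂ)), (∀ δ : ℝ, 0 < δ → Literature.Analysis.FunctionSpaces.IsPoissonPointProcess ((MeasureTheory.volume : MeasureTheory.Measure ℂ).withDensity (fun z => ENNReal.ofReal (ρ ((δ : ℂ) * z)))) (P δ)) → Literature.Analysis.FunctionSpaces.IsPoissonPointProcess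 (MeasureTheory.volume : MeasureTheory.Measure ℂ) Q → Filter.Tendsto (fun δ : ℝ => (Q.prod Q).real {c | ∃ x ∈ S.arc 0, ∃ y ∈ S.arc 2, JoinedIn (closure S.carrier ∩ {z | Metric.infDist (z / ((δ : ℝ) : ℂ)) (c.1 : Set ℂ) ≤ Metric.infDist (z / ((δ : ℝ) : ℂ)) (c.2 : Set ℂ)}) x y} - ((P δ).prod (P δ)).real {c | ∃ x ∈ R.arc 0, ∃ y ∈ R.arc 2, JoinedIn (closure R.carrier ∩ {z | Metric.infDist (z / ((δ : ℝ) : ℂ)) (c.1 : Set ℂ) ≤ Metric.infDist (z / ((δ : ℝ) : ℂ)) (c.2 : Set ℂ)}) x y}) (nhdsWithin (0 : ℝ) (Set.Ioi (0 : ℝ))) (nhds (0 : ℝ))) :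
    Sig.stub_conformalTransport := by
  intro R g U hU hRU hd hi
  obtain ⟨ρ, hρ, hV, hlim⟩ := h R (R.imageUnivalent g (hd.mono hRU) (hi.mono hRU)) g U hU hRU hd hi
    (MarkedDomain.carrier_imageUnivalent _ _ _ _) (fun i => MarkedDomain.arc_imageUnivalent _ _ _ _ i)
  refine ⟨ρ, hρ, hV, ?_⟩
  have hP : ∀ δ : ℝ, 0 < δ → IsPoissonPointProcess
      ((volume : Measure ℂ).withDensity fun z => ENNReal.ofReal (ρ ((δ : ℂ) * z)))
      (poissonLaw (intensity ρ 1 δ)) := by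
    intro δ _
    have := isPoissonPointProcess_poissonLaw_intensity ρ (AdmissibleDensity.continuous hρ) 1 δ
    rwa [intensity_one] at this ⊢
  have hQ : IsPoissonPointProcess (volume : Measure ℂ) (poissonLaw (volume : Measure ℂ)) :=
    isPoissonPointProcess_poissonLaw_volume
  have key := hlim (fun δ => poissonLaw (intensity ρ 1 δ)) (poissonLaw volume) hP hQ
  exact key.congr (fun δ => rfl)

/-- CHILD 3 ⇒ `Sig.stub_identification`. -/
theorem identification_of_statement
    (h : ∀ (Q : MeasureTheory.Measure (Literature.Analysis.FunctionSpaces.PointConfig ℂ)), Literature.Analysis.FunctionSpaces.IsPoissonPointProcess (MeasureTheory.volume : MeasureTheory.Measure ℂ) Q → (∀ (R S : Literature.Probability.RandomPlanarGeometry.ConformalRectangle) (h : ℂ → ℂ) (U : Set ℂ), IsOpen U → closure R.carrier ⊆ U → DifferentiableOn ℂ h U → Set.InjOn h U → S.carrier = h '' R.carrier → (∀ i : Fin 4, S.arc i = h '' R.arc i) → Filter.Tendsto (fun δ : ℝ => (Q.prod Q).real {c | ∃ x ∈ S.arc 0, ∃ y ∈ S.arc 2, JoinedIn (closure S.carrier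 ∩ {z | Metric.infDist (z / ((δ : ℝ) : ℂ)) (c.1 : Set ℂ) ≤ Metric.infDist (z / ((δ : ℝ) : ℂ)) (c.2 : Set ℂ)}) x y} - (Q.prod Q).real {c | ∃ x ∈ R.arc 0, ∃ y ∈ R.arc 2, JoinedIn (closure R.carrier ∩ {z | Metric.infDist (z / ((δ : ℝ) : ℂ)) (c.1 : Set ℂ) ≤ Metric.infDist (z / ((δ : ℝ) : ℂ)) (c.2 : Set ℂ)}) x y}) (nhdsWithin (0 : ℝ) (Set.Ioi (0 : ℝ))) (nhds (0 : ℝ))) → ∀ (R : Literature.Probability.RandomPlanarGeometry.ConformalRectangle) (φ : Literature.Probability.RandomPlanarGeometry.ConformalEquiv UpperHalfPlane.upperHalfPlaneSet R.carrier) (x : Fin 4 → ℝ), R.IsUniformizing φ x → ∀ (s : ℕ → ℝ) (L : ℝ), Filter.Tendsto s Filter.atTop (nhdsWithin (0 : ℝ) (Set.Ioi (0 : ℝ))) → Filter.Tendsto (fun n : ℕ => (Q.prod Q).real {c | ∃ x ∈ R.arc 0, ∃ y ∈ R.arc 2, JoinedIn (closure R.carrier ∩ {z | Metric.infDist (z /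 ((s n : ℝ) : ℂ)) (c.1 : Set ℂ) ≤ Metric.infDist (z / ((s n : ℝ) : ℂ)) (c.2 : Set ℂ)}) x y}) Filter.atTop (nhds L) → L = Literature.Probability.RandomPlanarGeometry.cardyFunction (Literature.Probability.RandomPlanarGeometry.crossRatio x)) :
    Sig.stub_identification := by
  intro hCN R φ x hφx s L hs hlim
  have hQ : IsPoissonPointProcess (volume : Measure ℂ) (poissonLaw (volume : Measure ℂ)) :=
    isPoissonPointProcess_poissonLaw_volume
  have hCI : ∀ (R S : ConformalRectangle) (g : ℂ → ℂ) (U : Set ℂ), IsOpen U → closure R.carrier ⊆ U →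
      DifferentiableOn ℂ g U → Set.InjOn g U → S.carrier = g '' R.carrier → (∀ i : Fin 4, S.arc i = g '' R.arc i) →
      Tendsto (fun δ : ℝ => ((poissonLaw volume).prod (poissonLaw volume)).real (crossEvent S δ)
        - ((poissonLaw volume).prod (poissonLaw volume)).real (crossEvent R δ)) (𝓝[>] 0) (𝓝 0) := by
    intro R S g U hU hRU hd hi hc ha
    have key := hCN R g U hU hRU hd hi
    refine key.congr (fun δ => ?_)
    show homCrossProb _ δ - homCrossProb R δ =
      ((poissonLaw volume).prod (poissonLaw volume)).real (crossEvent S δ)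
        - ((poissonLaw volume).prod (poissonLaw volume)).real (crossEvent R δ)
    rw [crossEvent_eq_of_image_data R S g (hd.mono hRU) (hi.mono hRU) hc ha δ]
    rfl
  exact h (poissonLaw volume) hQ hCI R φ x hφx s L hs hlim

/-! ### Converse bridges: the children are EQUIVALENT to the line's statements

(Rényi uniqueness `IsPoissonPointProcess.unique_holds`: any two Poisson laws of the same intensity coincide, so the
universally quantified laws of the S-form are the line's `poissonLaw` choices on `δ > 0`.)  Consequently a proof of
the line's `stub_conformalTransport` closes CHILD 2 in one line, `DensityBlind` closes CHILD 1, and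
`stub_identification` closes CHILD 3. -/

/-- `DensityBlind` ⇒ CHILD 1. -/
theorem statement_of_densityBlind (hD : DensityBlind) :
    ∀ (ρ : ℂ → ℝ), ContDiff ℝ (⊤ : ℕ∞) ρ → HasCompactSupport (fun x => ρ x - 1) → (∀ x, 0 < ρ x) → ∀ (P : ℝ → MeasureTheory.Measure (Literature.Analysis.FunctionSpaces.PointConfig ℂ)) (Q : MeasureTheory.Measure (Literature.Analysis.FunctionSpaces.PointConfig ℂ)), (∀ δ : ℝ, 0 < δ → Literature.Analysis.FunctionSpaces.IsPoissonPointProcess ((MeasureTheory.volume : MeasureTheory.Measure ℂ).withDensity (fun z => ENNReal.ofReal (ρ ((δ : ℂ) * z)))) (P δ)) → Literature.Analysis.FunctionSpaces.IsPoissonPointProcess (MeasureTheory.volume : MeasureTheory.Measure ℂ) Q → ∀ R : Literature.Probability.RandomPlanarGeometry.ConformalRectangle, Filter.Tendsto (fun δ : ℝ => ((P δ).prod (P δ)).real {c | ∃ x ∈ R.arc 0, ∃ y ∈ R.arc 2, JoinedIn (closure R.carrier ∩ {z | Metric.infDist (z / ((δ : ℝ) : ℂ)) (c.1 : Set ℂ)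 ≤ Metric.infDist (z / ((δ : ℝ) : ℂ)) (c.2 : Set ℂ)}) x y} - (Q.prod Q).real {c | ∃ x ∈ R.arc 0, ∃ y ∈ R.arc 2, JoinedIn (closure R.carrier ∩ {z | Metric.infDist (z / ((δ : ℝ) : ℂ)) (c.1 : Set ℂ) ≤ Metric.infDist (z / ((δ : ℝ) : ℂ)) (c.2 : Set ℂ)}) x y}) (nhdsWithin (0 : ℝ) (Set.Ioi (0 : ℝ))) (nhds (0 : ℝ)) := by
  intro ρ h1 h2 h3 P Q hP hQ R
  have hρ : AdmissibleDensity ρ := ⟨h1, h2, h3⟩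
  have key := hD ρ hρ R
  refine key.congr' ?_
  filter_upwards [self_mem_nhdsWithin] with δ hδ
  have hP' : IsPoissonPointProcess (intensity ρ 1 δ) (P δ) := by
    rw [intensity_one]; exact hP δ hδ
  haveI : IsLocallyFiniteMeasure (intensity ρ 1 δ) := by
    unfold intensity
    exact IsLocallyFiniteMeasure.withDensity_ofReal (continuous_densityPath_mul ρ hρ.continuous 1 δ)
  have hPδ : P δ = poissonLaw (intensity ρ 1 δ) :=
    IsPoissonPointProcess.unique_holds hP' (isPoissonPointProcess_poissonLaw_intensity ρ hρ.continuous 1 δ)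
  obtain rfl : Q = poissonLaw volume :=
    IsPoissonPointProcess.unique_holds hQ isPoissonPointProcess_poissonLaw_volume
  rw [hPδ]
  rw [crossProb_zero]
  rfl

/-- `Sig.stub_conformalTransport` ⇒ CHILD 2. -/
theorem statement_of_conformalTransport (hT : Sig.stub_conformalTransport) :
    ∀ (R S : Literature.Probability.RandomPlanarGeometry.ConformalRectangle) (h : ℂ → ℂ) (U : Set ℂ), IsOpen U → closure R.carrier ⊆ U → DifferentiableOn ℂ h U → Set.InjOn h U → S.carrier = h '' R.carrier → (∀ i : Fin 4, S.arc i = h '' R.arc i) → ∃ ρ : ℂ → ℝ, (ContDiff ℝ (⊤ : ℕ∞) ρ ∧ HasCompactSupport (fun x => ρ x - 1) ∧ ∀ x, 0 < ρ x) ∧ (∃ V : Set ℂ, IsOpen V ∧ closure R.carrier ⊆ V ∧ ∀ z ∈ V, ρ z = ‖deriv h z‖ ^ 2) ∧ ∀ (P : ℝ → MeasureTheory.Measure (Literature.Analysis.FunctionSpaces.PointConfig ℂ)) (Q : MeasureTheory.Measure (Literature.Analysis.FunctionSpaces.PointConfig ℂ)), (∀ δ : ℝ, 0 < δ → Literature.Analysis.FunctionSpaces.IsPoissonPointProcess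 ((MeasureTheory.volume : MeasureTheory.Measure ℂ).withDensity (fun z => ENNReal.ofReal (ρ ((δ : ℂ) * z)))) (P δ)) → Literature.Analysis.FunctionSpaces.IsPoissonPointProcess (MeasureTheory.volume : MeasureTheory.Measure ℂ) Q → Filter.Tendsto (fun δ : ℝ => (Q.prod Q).real {c | ∃ x ∈ S.arc 0, ∃ y ∈ S.arc 2, JoinedIn (closure S.carrier ∩ {z | Metric.infDist (z / ((δ : ℝ) : ℂ)) (c.1 : Set ℂ) ≤ Metric.infDist (z / ((δ : ℝ) : ℂ)) (c.2 : Set ℂ)}) x y} - ((P δ).prod (P δ)).real {c | ∃ x ∈ R.arc 0, ∃ y ∈ R.arc 2, JoinedIn (closure R.carrier ∩ {z | Metric.infDist (z / ((δ : ℝ) : ℂ)) (c.1 : Set ℂ) ≤ Metric.infDist (z / ((δ : ℝ) : ℂ)) (c.2 : Set ℂ)}) x y}) (nhdsWithin (0 : ℝ) (Set.Ioi (0 : ℝ))) (nhds (0 : ℝ)) := by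
  intro R S g U hU hRU hd hi hc ha
  obtain ⟨ρ, hρ, hV, hlim⟩ := hT R g U hU hRU hd hi
  refine ⟨ρ, hρ, hV, fun P Q hP hQ => ?_⟩
  refine hlim.congr' ?_
  filter_upwards [self_mem_nhdsWithin] with δ hδ
  have hP' : IsPoissonPointProcess (intensity ρ 1 δ) (P δ) := by
    rw [intensity_one]; exact hP δ hδ
  haveI : IsLocallyFiniteMeasure (intensity ρ 1 δ) := by
    unfold intensity
    exact IsLocallyFiniteMeasure.withDensity_ofReal (continuous_densityPath_mul ρ hρ.continuous 1 δ)
  have hPδ : P δ = poissonLaw (intensity ρ 1 δ) :=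
    IsPoissonPointProcess.unique_holds hP' (isPoissonPointProcess_poissonLaw_intensity ρ hρ.continuous 1 δ)
  obtain rfl : Q = poissonLaw volume :=
    IsPoissonPointProcess.unique_holds hQ isPoissonPointProcess_poissonLaw_volume
  rw [hPδ]
  show homCrossProb _ δ - crossProb ρ 1 R δ = _
  unfold homCrossProb lawBW
  rw [← crossEvent_eq_of_image_data R S g (hd.mono hRU) (hi.mono hRU) hc ha δ]
  rfl

/-- `Sig.stub_identification` ⇒ CHILD 3. -/
theorem statement_of_identification (hI : Sig.stub_identification) :
    ∀ (Q : MeasureTheory.Measure (Literature.Analysis.FunctionSpaces.PointConfig ℂ)), Literature.Analysis.FunctionSpaces.IsPoissonPointProcess (MeasureTheory.volume : MeasureTheory.Measure ℂ) Q → (∀ (R S : Literature.Probability.RandomPlanarGeometry.ConformalRectangle) (h : ℂ → ℂ) (U : Set ℂ), IsOpen U → closure R.carrier ⊆ U → DifferentiableOn ℂ h U → Set.InjOn h U → S.carrier = h '' R.carrier → (∀ i : Fin 4, S.arc i = h '' R.arc i) → Filter.Tendsto (fun δ : ℝ => (Q.prod Q).real {c | ∃ x ∈ S.arc 0, ∃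 y ∈ S.arc 2, JoinedIn (closure S.carrier ∩ {z | Metric.infDist (z / ((δ : ℝ) : ℂ)) (c.1 : Set ℂ) ≤ Metric.infDist (z / ((δ : ℝ) : ℂ)) (c.2 : Set ℂ)}) x y} - (Q.prod Q).real {c | ∃ x ∈ R.arc 0, ∃ y ∈ R.arc 2, JoinedIn (closure R.carrier ∩ {z | Metric.infDist (z / ((δ : ℝ) : ℂ)) (c.1 : Set ℂ) ≤ Metric.infDist (z / ((δ : ℝ) : ℂ)) (c.2 : Set ℂ)}) x y}) (nhdsWithin (0 : ℝ) (Set.Ioi (0 : ℝ))) (nhds (0 : ℝ))) → ∀ (R : Literature.Probability.RandomPlanarGeometry.ConformalRectangle) (φ : Literature.Probability.RandomPlanarGeometry.ConformalEquiv UpperHalfPlane.upperHalfPlaneSet R.carrier) (x : Fin 4 → ℝ), R.IsUniformizing φ x → ∀ (s : ℕ → ℝ) (L : ℝ), Filter.Tendsto s Filter.atTop (nhdsWithin (0 : ℝ) (Set.Ioi (0 : ℝ))) → Filter.Tendsto (fun n : ℕ => (Q.prod Q).real {c | ∃ x ∈ R.arc 0, ∃ y ∈ R.arc 2, JoinedIn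 (closure R.carrier ∩ {z | Metric.infDist (z / ((s n : ℝ) : ℂ)) (c.1 : Set ℂ) ≤ Metric.infDist (z / ((s n : ℝ) : ℂ)) (c.2 : Set ℂ)}) x y}) Filter.atTop (nhds L) → L = Literature.Probability.RandomPlanarGeometry.cardyFunction (Literature.Probability.RandomPlanarGeometry.crossRatio x) := by
  intro Q hQ hCI R φ x hφx s L hs hlim
  obtain rfl : Q = poissonLaw volume :=
    IsPoissonPointProcess.unique_holds hQ isPoissonPointProcess_poissonLaw_volume
  have hCN : ConformalNull := by
    intro R g U hU hRU hd hi
    have key := hCI R (R.imageUnivalent g (hd.mono hRU) (hi.mono hRU)) g U hU hRU hd hi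
      (MarkedDomain.carrier_imageUnivalent _ _ _ _) (fun i => MarkedDomain.arc_imageUnivalent _ _ _ _ i)
    exact key.congr (fun δ => rfl)
  exact hI hCN R φ x hφx s L hs hlim

/-! ### The split glue, by name -/

/-- **Route-level split of the crux.**  CHILD 1 → CHILD 2 → CHILD 3 → `CardyFlipRusso.VoronoiHubFromSmirnov` BY NAME
(through the bridges above and the landed `VoronoiHubFromSmirnov_of_densityBlind`, p126642); the hypothesis types are
the three children verbatim, so after the split this term proves the gate's glue item
`CardyFlipRusso.VoronoiHubFromSmirnovOfSubs` by `fun h1 h2 h3 => VoronoiHubFromSmirnov_of_subs h1 h2 h3`. -/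
theorem VoronoiHubFromSmirnov_of_subs :
    (∀ (ρ : ℂ → ℝ), ContDiff ℝ (⊤ : ℕ∞) ρ → HasCompactSupport (fun x => ρ x - 1) → (∀ x, 0 < ρ x) → ∀ (P : ℝ → MeasureTheory.Measure (Literature.Analysis.FunctionSpaces.PointConfig ℂ)) (Q : MeasureTheory.Measure (Literature.Analysis.FunctionSpaces.PointConfig ℂ)), (∀ δ : ℝ, 0 < δ → Literature.Analysis.FunctionSpaces.IsPoissonPointProcess ((MeasureTheory.volume : MeasureTheory.Measure ℂ).withDensity (fun z => ENNReal.ofReal (ρ ((δ : ℂ) * z)))) (P δ)) → Literature.Analysis.FunctionSpaces.IsPoissonPointProcess (MeasureTheory.volume : MeasureTheory.Measure ℂ) Q → ∀ R : Literature.Probability.RandomPlanarGeometry.ConformalRectangle, Filter.Tendsto (fun δ : ℝ => ((P δ).prod (P δ)).real {c | ∃ x ∈ R.arc 0, ∃ y ∈ R.arc 2, JoinedIn (closure R.carrier ∩ {z | Metric.infDist (z / ((δ : ℝ) : ℂ)) (c.1 : Set ℂ) ≤ Metric.infDist (z / ((δ : ℝ) : ℂ)) (c.2 : Set ℂ)})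 x y} - (Q.prod Q).real {c | ∃ x ∈ R.arc 0, ∃ y ∈ R.arc 2, JoinedIn (closure R.carrier ∩ {z | Metric.infDist (z / ((δ : ℝ) : ℂ)) (c.1 : Set ℂ) ≤ Metric.infDist (z / ((δ : ℝ) : ℂ)) (c.2 : Set ℂ)}) x y}) (nhdsWithin (0 : ℝ) (Set.Ioi (0 : ℝ))) (nhds (0 : ℝ))) →
    (∀ (R S : Literature.Probability.RandomPlanarGeometry.ConformalRectangle) (h : ℂ → ℂ) (U : Set ℂ), IsOpen U → closure R.carrier ⊆ U → DifferentiableOn ℂ h U → Set.InjOn h U → S.carrier = h '' R.carrier → (∀ i : Fin 4, S.arc i = h '' R.arc i) → ∃ ρ : ℂ → ℝ, (ContDiff ℝ (⊤ : ℕ∞) ρ ∧ HasCompactSupport (fun x => ρ x - 1) ∧ ∀ x, 0 < ρ x) ∧ (∃ V : Set ℂ, IsOpen V ∧ closure R.carrier ⊆ V ∧ ∀ z ∈ V, ρ z = ‖deriv h z‖ ^ 2) ∧ ∀ (P : ℝ → MeasureTheory.Measure (Literature.Analysis.FunctionSpaces.PointConfig ℂ)) (Q : MeasureTheory.Measure (Literature.Analysis.FunctionSpaces.PointConfig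 ℂ)), (∀ δ : ℝ, 0 < δ → Literature.Analysis.FunctionSpaces.IsPoissonPointProcess ((MeasureTheory.volume : MeasureTheory.Measure ℂ).withDensity (fun z => ENNReal.ofReal (ρ ((δ : ℂ) * z)))) (P δ)) → Literature.Analysis.FunctionSpaces.IsPoissonPointProcess (MeasureTheory.volume : MeasureTheory.Measure ℂ) Q → Filter.Tendsto (fun δ : ℝ => (Q.prod Q).real {c | ∃ x ∈ S.arc 0, ∃ y ∈ S.arc 2, JoinedIn (closure S.carrier ∩ {z | Metric.infDist (z / ((δ : ℝ) : ℂ)) (c.1 : Set ℂ) ≤ Metric.infDist (z / ((δ : ℝ) : ℂ)) (c.2 : Set ℂ)}) x y} - ((P δ).prod (P δ)).real {c | ∃ x ∈ R.arc 0, ∃ y ∈ R.arc 2, JoinedIn (closure R.carrier ∩ {z | Metric.infDist (z / ((δ : ℝ) : ℂ)) (c.1 : Set ℂ) ≤ Metric.infDist (z / ((δ : ℝ) : ℂ)) (c.2 : Set ℂ)}) x y}) (nhdsWithin (0 : ℝ) (Set.Ioi (0 : ℝ))) (nhds (0 : ℝ))) →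
    (∀ (Q : MeasureTheory.Measure (Literature.Analysis.FunctionSpaces.PointConfig ℂ)), Literature.Analysis.FunctionSpaces.IsPoissonPointProcess (MeasureTheory.volume : MeasureTheory.Measure ℂ) Q → (∀ (R S : Literature.Probability.RandomPlanarGeometry.ConformalRectangle) (h : ℂ → ℂ) (U : Set ℂ), IsOpen U → closure R.carrier ⊆ U → DifferentiableOn ℂ h U → Set.InjOn h U → S.carrier = h '' R.carrier → (∀ i : Fin 4, S.arc i = h '' R.arc i) → Filter.Tendsto (fun δ : ℝ => (Q.prod Q).real {c | ∃ x ∈ S.arc 0, ∃ y ∈ S.arc 2, JoinedIn (closure S.carrier ∩ {z | Metric.infDist (z / ((δ : ℝ) : ℂ)) (c.1 : Set ℂ) ≤ Metric.infDist (z / ((δ : ℝ) : ℂ)) (c.2 : Set ℂ)}) x y} - (Q.prod Q).real {c | ∃ x ∈ R.arc 0, ∃ y ∈ R.arc 2, JoinedIn (closure R.carrier ∩ {z | Metric.infDist (z / ((δ : ℝ) : ℂ)) (c.1 : Set ℂ) ≤ Metric.infDist (z / ((δ : ℝ) : ℂ)) (c.2 : Set ℂ)}) x y}) (nhdsWithin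 (0 : ℝ) (Set.Ioi (0 : ℝ))) (nhds (0 : ℝ))) → ∀ (R : Literature.Probability.RandomPlanarGeometry.ConformalRectangle) (φ : Literature.Probability.RandomPlanarGeometry.ConformalEquiv UpperHalfPlane.upperHalfPlaneSet R.carrier) (x : Fin 4 → ℝ), R.IsUniformizing φ x → ∀ (s : ℕ → ℝ) (L : ℝ), Filter.Tendsto s Filter.atTop (nhdsWithin (0 : ℝ) (Set.Ioi (0 : ℝ))) → Filter.Tendsto (fun n : ℕ => (Q.prod Q).real {c | ∃ x ∈ R.arc 0, ∃ y ∈ R.arc 2, JoinedIn (closure R.carrier ∩ {z | Metric.infDist (z / ((s n : ℝ) : ℂ)) (c.1 : Set ℂ) ≤ Metric.infDist (z / ((s n : ℝ) : ℂ)) (c.2 : Set ℂ)}) x y}) Filter.atTop (nhds L) → L = Literature.Probability.RandomPlanarGeometry.cardyFunction (Literature.Probability.RandomPlanarGeometry.crossRatio x)) →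
      Summit.CriticalPhenomena.CardyFormulaZ2.Theses.CardyFlipRusso.VoronoiHubFromSmirnov :=
  fun h1 h2 h3 => VoronoiHubFromSmirnov_of_densityBlind (densityBlind_of_statement h1)
    (conformalTransport_of_statement h2) (identification_of_statement h3)

end Summit.CriticalPhenomena.CardyFormulaZ2.Cruxes.VoronoiHubFromSmirnov.MoebiusExactDelaunayDilationWard

end
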